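import Summits.KontsevichZagierPeriods.KontsevichZagierPeriods.Theorems.SoloInformedAffineRadical
import HarnessLib
import HarnessLib.Audit

/-!
# SoloInformed — reflection and two-component domains for `√((x − β)² − α²)`

Solo programme `solo-KontsevichZagierPeriods-informed`, session s112, file 31.

File 30 treats `(A + B√((x − β)² − α²))/C` on domains `⊆ [β + α, ∞)`.  The reflection `x = −v`
(the `K`-affine move with `(α, β) = (−1, 0)`) carries the left branch `x ≤ β − α` to the right
branch of `√((v + β)² − α²)` (`soloInformed_segSpan_of_sqrtQuadratic_left`), and additivity over
the two semialgebraic pieces `{x ≤ β − α}`, `{x ≥ β + α}` (`soloInformed_segSpan_of_two_pieces`)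
gives the natural domain `|x − β| ≥ α` (`soloInformed_segSpan_of_sqrtQuadratic_twoSided`).  With
files 29–30 this completes: **for every quadratic `q` over `K` in normal form and every admissible
`ℚ`-semialgebraic domain on which `q ≥ 0` (strictly inside the root interval at its left end),
absolutely convergent `∫_D (A + B√q)/C dx` with equal values are KZ-equivalent**
(`soloInformed_kzp_sqrtQuadratic_twoSided`).

References: M. Kontsevich, D. Zagier, *Periods* (2001), §1.1–1.2; A. Baker (1975), Thm. 2.1.
-/

noncomputable section

open scoped BigOperators Polynomial

namespace Summit.KontsevichZagierPeriods.KontsevichZagierPeriods.Theorems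

open Set MeasureTheory
open Literature.ModelTheory.ExponentialFields
open Literature.NumberTheory.Transcendental Literature.NumberTheory.Transcendental.KZ

/-! ## Additivity over pieces -/

/-- **Pieces:** if finitely many semialgebraic pieces cover the domain up to a null set, overlap in
null sets, and each restriction lies in the span of points and segments, then so does `r`.
[Kontsevich–Zagier 2001, §1.2 rule (1)] -/
theorem soloInformed_segSpan_of_pieces {ι : Type*} [Fintype ι] (r : IntegralRep 1)
    (D : ι → Set (Fin 1 → ℝ)) (hD : ∀ i, IsSemialgebraic ℚ (D i)) (hsub : ∀ i, D i ⊆ r.domain)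
    (hcov : volume (r.domain \ ⋃ i, D i) = 0)
    (hdisj : Pairwise fun i j => volume (D i ∩ D j) = 0)
    (h : ∀ i, of (r.restrict (D i) (hD i) (hsub i)) ∈ soloInformedSegSpan) :
    of r ∈ soloInformedSegSpan := by
  classical
  set R : ι → IntegralRep 1 := fun i => r.restrict (D i) (hD i) (hsub i) with hR
  have hrel : of r - ∑ i, of (R i) ∈ relations := by
    refine of_sub_sum_of_mem_relations Finset.univ r R (fun i _ => ?_) (fun i _ _ _ => rfl) ?_
      fun i _ j _ hij => ?_
    · rw [show (R i).domain \ r.domain = ∅ from sdiff_eq_empty.mpr (hsub i), measure_empty]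
    · have h : r.domain \ ⋃ i ∈ (Finset.univ : Finset ι), (R i).domain = r.domain \ ⋃ i, D i := by
        congr 1
        ext x
        simp [hR]
      rw [h]
      exact hcov
    · exact hdisj hij
  exact soloInformed_mem_segSpan_of_sub_mem hrel (soloInformed_sum_mem_segSpan _ fun i _ => h i)

/-- **Two pieces** (the case used below): `D ⊆ S ∪ T`, `S ∩ T = ∅`, both restrictions in the span. -/
theorem soloInformed_segSpan_of_two_pieces (r : IntegralRep 1) (S T : Set (Fin 1 → ℝ))
    (hS : IsSemialgebraic ℚ S) (hT : IsSemialgebraic ℚ T) (hSr : S ⊆ r.domain) (hTr : T ⊆ r.domain)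
    (hcov : r.domain ⊆ S ∪ T) (hdisj : S ∩ T = ∅)
    (h₁ : of (r.restrict S hS hSr) ∈ soloInformedSegSpan)
    (h₂ : of (r.restrict T hT hTr) ∈ soloInformedSegSpan) : of r ∈ soloInformedSegSpan := by
  refine soloInformed_segSpan_of_pieces r (fun b => cond b S T)
    (fun b => by cases b <;> assumption) (fun b => by cases b <;> assumption) ?_ ?_
    fun b => by cases b <;> assumption
  · rw [show r.domain \ ⋃ b, cond b S T = ∅ from ?_, measure_empty]
    refine Set.eq_empty_iff_forall_notMem.2 fun x hx => hx.2 ?_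
    rcases hcov hx.1 with h | h
    · exact mem_iUnion.2 ⟨true, h⟩
    · exact mem_iUnion.2 ⟨false, h⟩
  · intro i j hij
    cases i <;> cases j
    · exact absurd rfl hij
    · rw [show (cond false S T) ∩ (cond true S T) = ∅ by rw [inter_comm]; exact hdisj, measure_empty]
    · rw [show (cond true S T) ∩ (cond false S T) = ∅ from hdisj, measure_empty]
    · exact absurd rfl hij

/-! ## Reflection: the left branch -/

/-- **Left branch by reflection:** `(A + B√((x − β)² − α²))/C` on `D ⊆ (−∞, β − α]` lies in the span
(substitute `x = −v`, landing in the right branch of `√((v − (−β))² − α²)`). -/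
theorem soloInformed_segSpan_of_sqrtQuadratic_left (r : IntegralRep 1) (α β : algebraicClosure ℚ ℝ)
    (A B C : (algebraicClosure ℚ ℝ)[X]) (hα : 0 < algebraMap _ ℝ α)
    (hC : ∀ x ∈ r.domain, (Polynomial.aeval (x 0) C : ℝ) ≠ 0)
    (hD : ∀ x ∈ r.domain, x 0 ≤ algebraMap _ ℝ β - algebraMap _ ℝ α)
    (hf : EqOn r.integrand (fun x => ((Polynomial.aeval (x 0) A : ℝ) + Polynomial.aeval (x 0) B *
      Real.sqrt ((x 0 - algebraMap _ ℝ β) ^ 2 - (algebraMap _ ℝ α) ^ 2)) /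
      Polynomial.aeval (x 0) C) r.domain) :
    of r ∈ soloInformedSegSpan := by
  have hne : algebraMap (algebraicClosure ℚ ℝ) ℝ (-1) ≠ 0 := by rw [map_neg, map_one]; norm_num
  obtain ⟨R', hdom, hint, hrel⟩ := soloInformed_exists_affineSubst (-1) 0 hne r
  refine soloInformed_segSpan_of_subst hrel (soloInformed_segSpan_of_isKSqrtQuadraticOne R' ?_)
  have hpt : ∀ u : Fin 1 → ℝ, soloInformedScaleMoveR 0 (algebraMap (algebraicClosure ℚ ℝ) ℝ 0)
      (algebraMap (algebraicClosure ℚ ℝ) ℝ (-1)) u 0 = -u 0 := fun u => by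
    rw [(soloInformed_affine_apply _ _ u).1, map_zero, map_neg, map_one]; ring
  have hdet : |(soloInformedScaleDerivR (n := 1) 0 (algebraMap (algebraicClosure ℚ ℝ) ℝ (-1))).det| = 1 := by
    rw [(soloInformed_affine_apply (algebraMap (algebraicClosure ℚ ℝ) ℝ (-1))
      (algebraMap (algebraicClosure ℚ ℝ) ℝ 0) 0).2, map_neg, map_one, abs_neg, abs_one]
  have hmem : ∀ u ∈ R'.domain, soloInformedScaleMoveR 0 (algebraMap (algebraicClosure ℚ ℝ) ℝ 0)
      (algebraMap (algebraicClosure ℚ ℝ) ℝ (-1)) u ∈ r.domain := fun u hu => by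
    rw [hdom] at hu; exact hu.2
  have hcomp : ∀ (P : (algebraicClosure ℚ ℝ)[X]) (u : ℝ),
      (Polynomial.aeval u (soloInformedAffComp (-1) 0 P) : ℝ) = Polynomial.aeval (-u) P := fun P u => by
    rw [soloInformed_aeval_affComp, map_zero, map_neg, map_one, zero_add, neg_one_mul]
  refine ⟨α, -β, soloInformedAffComp (-1) 0 A, soloInformedAffComp (-1) 0 B,
    soloInformedAffComp (-1) 0 C, hα, fun u hu => ?_, Or.inr (Or.inr ⟨fun u hu => ?_, fun u hu => ?_⟩)⟩
  · rw [hcomp, ← hpt u]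
    exact hC _ (hmem u hu)
  · have h := hD _ (hmem u hu)
    rw [hpt] at h
    rw [map_neg]
    linarith
  · rw [hint]
    show r.integrand _ * _ = _
    rw [hdet, mul_one, hf (hmem u hu)]
    show ((Polynomial.aeval (soloInformedScaleMoveR 0 _ _ u 0) A : ℝ) +
        Polynomial.aeval (soloInformedScaleMoveR 0 _ _ u 0) B *
          Real.sqrt ((soloInformedScaleMoveR 0 _ _ u 0 - algebraMap _ ℝ β) ^ 2 - (algebraMap _ ℝ α) ^ 2)) /
        Polynomial.aeval (soloInformedScaleMoveR 0 _ _ u 0) C =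
      ((Polynomial.aeval (u 0) (soloInformedAffComp (-1) 0 A) : ℝ) +
        Polynomial.aeval (u 0) (soloInformedAffComp (-1) 0 B) *
          Real.sqrt ((u 0 - algebraMap _ ℝ (-β)) ^ 2 - (algebraMap _ ℝ α) ^ 2)) /
        Polynomial.aeval (u 0) (soloInformedAffComp (-1) 0 C)
    have hs : (-u 0 - algebraMap (algebraicClosure ℚ ℝ) ℝ β) ^ 2 =
        (u 0 - algebraMap (algebraicClosure ℚ ℝ) ℝ (-β)) ^ 2 := by rw [map_neg]; ring
    rw [hpt u, hcomp, hcomp, hcomp, hs]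

/-! ## Two-sided domains `|x − β| ≥ α` -/

/-- **`(A + B√((x − β)² − α²))/C` on any domain with `|x − β| ≥ α`** lies in the span of points and
segments. -/
theorem soloInformed_segSpan_of_sqrtQuadratic_twoSided (r : IntegralRep 1) (α β : algebraicClosure ℚ ℝ)
    (A B C : (algebraicClosure ℚ ℝ)[X]) (hα : 0 < algebraMap _ ℝ α)
    (hC : ∀ x ∈ r.domain, (Polynomial.aeval (x 0) C : ℝ) ≠ 0)
    (hD : ∀ x ∈ r.domain, x 0 ≤ algebraMap _ ℝ β - algebraMap _ ℝ α ∨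
      algebraMap _ ℝ β + algebraMap _ ℝ α ≤ x 0)
    (hf : EqOn r.integrand (fun x => ((Polynomial.aeval (x 0) A : ℝ) + Polynomial.aeval (x 0) B *
      Real.sqrt ((x 0 - algebraMap _ ℝ β) ^ 2 - (algebraMap _ ℝ α) ^ 2)) /
      Polynomial.aeval (x 0) C) r.domain) :
    of r ∈ soloInformedSegSpan := by
  have hK := soloInformed_isAlgebraic_algebraMap_K
  -- the two pieces
  set S : Set (Fin 1 → ℝ) := {x | x ∈ r.domain ∧ x 0 ≤ algebraMap _ ℝ β - algebraMap _ ℝ α} with hSdef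
  set T : Set (Fin 1 → ℝ) := {x | x ∈ r.domain ∧ algebraMap _ ℝ β + algebraMap _ ℝ α ≤ x 0} with hTdef
  have hS : IsSemialgebraic ℚ S := by
    have h := (soloInformed_isSemialgebraicFunOn_aevalK hK r.isSemialgebraic_domain
      (MvPolynomial.C (β - α) - MvPolynomial.X 0 : MvPolynomial (Fin 1) (algebraicClosure ℚ ℝ))).isSemialgebraic_sep_nonneg
    convert h using 2 with x
    simp [sub_nonneg, map_sub]
  have hT : IsSemialgebraic ℚ T := by
    have h := (soloInformed_isSemialgebraicFunOn_aevalK hK r.isSemialgebraic_domain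
      (MvPolynomial.X 0 - MvPolynomial.C (β + α) : MvPolynomial (Fin 1) (algebraicClosure ℚ ℝ))).isSemialgebraic_sep_nonneg
    convert h using 2 with x
    simp [sub_nonneg, map_add]
  have hSr : S ⊆ r.domain := fun x hx => hx.1
  have hTr : T ⊆ r.domain := fun x hx => hx.1
  refine soloInformed_segSpan_of_two_pieces r S T hS hT hSr hTr (fun x hx => ?_) ?_ ?_ ?_
  · rcases hD x hx with h | h
    · exact Or.inl ⟨hx, h⟩
    · exact Or.inr ⟨hx, h⟩
  · refine Set.eq_empty_iff_forall_notMem.2 fun x hx => ?_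
    have h1 := hx.1.2
    have h2 := hx.2.2
    linarith
  · exact soloInformed_segSpan_of_sqrtQuadratic_left _ α β A B C hα (fun x hx => hC x hx.1)
      (fun x hx => hx.2) fun x hx => hf hx.1
  · exact soloInformed_segSpan_of_isKSqrtQuadraticOne _ ⟨α, β, A, B, C, hα, fun x hx => hC x hx.1,
      Or.inr (Or.inr ⟨fun x hx => hx.2, fun x hx => hf hx.1⟩)⟩

/-- **The period conjecture for `(A + B√((x − β)² − α²))/C` on two-sided domains** against every
class of files 17–30 with the same value: KZ-equivalent. Unconditional. [this work] -/
theorem soloInformed_kzp_sqrtQuadratic_twoSided (r : IntegralRep 1) (α β : algebraicClosure ℚ ℝ)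
    (A B C : (algebraicClosure ℚ ℝ)[X]) (hα : 0 < algebraMap _ ℝ α)
    (hC : ∀ x ∈ r.domain, (Polynomial.aeval (x 0) C : ℝ) ≠ 0)
    (hD : ∀ x ∈ r.domain, x 0 ≤ algebraMap _ ℝ β - algebraMap _ ℝ α ∨
      algebraMap _ ℝ β + algebraMap _ ℝ α ≤ x 0)
    (hf : EqOn r.integrand (fun x => ((Polynomial.aeval (x 0) A : ℝ) + Polynomial.aeval (x 0) B *
      Real.sqrt ((x 0 - algebraMap _ ℝ β) ^ 2 - (algebraMap _ ℝ α) ^ 2)) /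
      Polynomial.aeval (x 0) C) r.domain) :
    (∀ r₁ : IntegralRep 1, SoloInformedIsKSqrtQuadraticOne r₁ → r.value = r₁.value → Equivalent r r₁) ∧
    (∀ r₁ : IntegralRep 1, SoloInformedIsKQuadRadicalOne r₁ → r.value = r₁.value → Equivalent r r₁) ∧
    (∀ r₁ : IntegralRep 1, SoloInformedIsKRationalOne r₁ → r.value = r₁.value → Equivalent r r₁) ∧
    (∀ {n : ℕ} (hn : n ≤ 1) (r₀ : IntegralRep n), r₀.IsRational → r.value = r₀.value →
      Equivalent r r₀) ∧
    (∀ {m : ℕ} (r₂ : IntegralRep m), of r₂ ∈ soloInformedSegSpan → r.value = r₂.value →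
      Equivalent r r₂) := by
  have h := soloInformed_segSpan_of_sqrtQuadratic_twoSided r α β A B C hα hC hD hf
  exact ⟨fun r₁ hr₁ hv => soloInformed_equivalent_of_mem_segSpan h
      (soloInformed_segSpan_of_isKSqrtQuadraticOne r₁ hr₁) hv,
    fun r₁ hr₁ hv => soloInformed_equivalent_of_mem_segSpan h
      (soloInformed_segSpan_of_isKQuadRadicalOne r₁ hr₁) hv,
    fun r₁ hr₁ hv => soloInformed_equivalent_of_mem_segSpan h
      (soloInformed_segSpan_of_isKRationalOne r₁ hr₁) hv,
    fun hn r₀ hr₀ hv => soloInformed_equivalent_of_mem_segSpan h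
      (soloInformed_of_mem_segSpan_of_isRational hn r₀ hr₀) hv,
    fun r₂ hr₂ hv => soloInformed_equivalent_of_mem_segSpan h hr₂ hv⟩

end Summit.KontsevichZagierPeriods.KontsevichZagierPeriods.Theorems
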